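import Mathlib
import HarnessLib
import HarnessLib.Audit
import Summits.CriticalPhenomena.Statement
import Literature.Probability.RandomPlanarGeometry.HexParafermion
import Literature.Probability.RandomPlanarGeometry.HexSAW
import Literature.Probability.RandomPlanarGeometry.SLEConvergenceCriterion
import Literature.Probability.RandomPlanarGeometry.ConformalMap
import HarnessLib.Audit.Status.Attr

/-!
Route: SAWWindingAlias

DORMANT since 2026-08-26T10:52:56Z (reconciler: no traction for 8.3 d (last activity item-evidence-added at 2026-08-18T02:01:51Z); parked, not closed — `ledger route dormant route-CriticalPhenomena-SAWWindingAlias --off` to reactivate) — unstaffed, not closed; items shared with open routes are served there. `ledger route dormant <id> --off` reactivates.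

# Route SAWWindingAlias — the missing half of Cauchy–Riemann is one winding alias (spin −11/8) → 0;
plus boundary-flux covariance, glued by the exact Green identity of DCS Lemma 1

It suffices to show X = HexObservableLimitR — the typed, smeared, b-normalised form of
Duminil-Copin–Smirnov 2012 Conjecture 2 on the
HEXAGONAL lattice with BOTH marked points pinned conformally (flat horizontal boundary piece + exact
half-lattice in a ball at a and at b; the shared
repaired target stmt-14003 of SAWDefectDecoherence / SAWDevelopingMap / SAWPhaseRetrieval /
SAWResidueField, adopted VERBATIM after the unpinned
stmt-5420 fell to the boundary-corridor witness SAWDefectDecoherenceHexObservableLimit_refuted) —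
and this route splits X, through the EXACT Green
identity obtained by summing DCS Lemma 1 against a test function, into an INTERIOR statement and a
BOUNDARY statement (card winding-alias-tower-twistnull, spine):
 (TN) TwistNull: the winding ALIAS of the observable — the same sum taken at spin 5/8 − 2 = −11/8,
which edge by edge equals e^(2i(θ_e − θ_a)) F_δ(e)
      (AliasIdentity), so that |F^(−11/8)(e)| = |F^(5/8)(e)| pointwise and only cancellation ACROSS
edge-direction classes can make it small — is o(1)
      against test functions: |Σ_inner ψ(δe) F^(−11/8)_δ(e)| ≤ ε ‖ψ‖_∞ Σ_{inner e, δe ∈ K} |F_δ(e)|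
eventually, for every compact K ∌ a and ψ ∈ C_c with
      supp ψ ⊆ int K (rev 15: sup-norm × unsmeared K-mass, the repair C′ of the re-entrant-wedge
witness that isolates one straddling inner edge under the
      old smeared-mass normalisation); this is the weak form of the missing half of the discrete
Cauchy–Riemann relations ("F_δ has the same limit
      regardless of the orientation of the edge", DCS §4);
 (BF) BoundaryFluxLimit: the normalised complex flux of F_δ through the discrete boundary (boundary
arc partition functions with their deterministic
      winding phases) converges, in Green form, to c'∫_Ω (φ'/φ'(b))^(5/8) ∂̄ϕ dA with one universal
c' ≠ 0;
 (GS) GreenSynthesis: (TN) → (BF) → X — the b-normalised mass bound δ²Σ_K |F_δ| ≤ C_K |F_δ(b_δ)|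
(vague precompactness on ℂ∖{a}), the exact Green
      identity flux = (1/√3)[alias(∂ϕ) + observable(∂̄ϕ)] + O(δ·mass), Weyl's lemma and analytic
continuation of the defect measure across ∂Ω.
X feeds the conjunct through the shared pipeline HexTight + ObservableToSLE (X ⇒ hexagonal SLE(8/3),
shared stmt-14005) + HexTransfer (hexagonal SLE(8/3) ⇒
the δℤ² Statement, shared with SAWPhaseRetrieval).
Lean: `∃ c : ℂ, c ≠ 0 ∧ ∀ (D : Literature.Probability.RandomPlanarGeometry.DobrushinDomain) (ρ : ℝ)
(Λ : ℝ → Finset Literature.Probability.LatticeModels.HexVertex) (m : Fin 2 → ℝ → ℤ) (a b : ℝ → Sym2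
Literature.Probability.LatticeModels.HexVertex) (Φ :
Literature.Probability.RandomPlanarGeometry.ConformalEquiv D.carrier
UpperHalfPlane.upperHalfPlaneSet) (L : ℂ → ℂ) (Lb : ℂ) (ψ : ℂ → ℂ), let F : ℝ → Sym2
Literature.Probability.LatticeModels.HexVertex → ℂ := fun δ z =>
Literature.Probability.RandomPlanarGeometry.SAW.hexParafermionicObservable (Λ δ) (a δ)
Literature.Probability.RandomPlanarGeometry.SAW.hexCriticalFugacity (5 / 8) z; 0 < ρ → (∀ i : Fin 2,
D.carrier ∩ Metric.ball (D.pt i) ρ = {z : ℂ | (D.pt i).im < z.im} ∩ Metric.ball (D.pt i) ρ) → (∀ᶠ δ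
: ℝ in nhdsWithin 0 (Set.Ioi 0),
Literature.Probability.RandomPlanarGeometry.SAW.hexDomainSimplyConnected (Λ δ) ∧ a δ ∈
Literature.Probability.RandomPlanarGeometry.SAW.hexDomainBoundary (Λ δ) ∧ b δ ∈
Literature.Probability.RandomPlanarGeometry.SAW.hexDomainBoundary (Λ δ) ∧ Nonempty
(Literature.Probability.RandomPlanarGeometry.SAW.HexMidEdgeSAW (Λ δ) (a δ) (b δ)) ∧
(Literature.Probability.LatticeModels.hexGraph.induce ((Λ δ : Finset
Literature.Probability.LatticeModels.HexVertex) : Set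
Literature.Probability.LatticeModels.HexVertex)).Preconnected ∧ (∀ v ∈ Λ δ, (δ : ℂ) *
Literature.Probability.LatticeModels.hexCenter v ∈ D.carrier) ∧ (∀ i : Fin 2, ∀ v :
Literature.Probability.LatticeModels.HexVertex, (δ : ℂ) *
Literature.Probability.LatticeModels.hexCenter v ∈ Metric.ball (D.pt i) ρ → (v ∈ Λ δ ↔ m i δ ≤ v.1
1))) → (∀ K : Set ℂ, IsCompact K → K ⊆ D.carrier → ∀ᶠ δ : ℝ in nhdsWithin 0 (Set.Ioi 0), ∀ v :
Literature.Probability.LatticeModels.HexVertex, (δ : ℂ) *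
Literature.Probability.LatticeModels.hexCenter v ∈ K → v ∈ Λ δ) → Filter.Tendsto (fun δ : ℝ => (δ :
ℂ) * Literature.Probability.RandomPlanarGeometry.SAW.hexMidpoint (a δ)) (nhdsWithin 0 (Set.Ioi 0))
(nhds (D.pt 0)) → Filter.Tendsto (fun δ : ℝ => (δ : ℂ) *
Literature.Probability.RandomPlanarGeometry.SAW.hexMidpoint (b δ)) (nhdsWithin 0 (Set.Ioi 0)) (nhds
(D.pt 1)) → Filter.Tendsto (fun x => ‖Φ x‖) (nhdsWithin (D.pt 0) D.carrier) Filter.atTop →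
Φ.HasBoundaryValue (D.pt 1) 0 → ContinuousOn L D.carrier → (∀ z ∈ D.carrier, Complex.exp (L z) =
deriv Φ z) → Filter.Tendsto L (nhdsWithin (D.pt 1) D.carrier) (nhds Lb) → Continuous ψ →
HasCompactSupport ψ → tsupport ψ ⊆ D.carrier → Filter.Tendsto (fun δ : ℝ => (δ : ℂ) ^ 2 * (∑ᶠ e ∈
Literature.Probability.RandomPlanarGeometry.SAW.hexDomainMidEdges (Λ δ), ψ ((δ : ℂ) *
Literature.Probability.RandomPlanarGeometry.SAW.hexMidpoint e) * F δ e) / F δ (b δ)) (nhdsWithin 0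
(Set.Ioi 0)) (nhds (c * ∫ z, ψ z * Complex.exp ((5 / 8 : ℂ) * (L z - Lb))))`

## Assembly
Deciding theorem `closes` (rev 16; certified sorry-free on the simulated post-edit file, lean rc 0,
0 warnings, axioms propext/Classical.choice/Quot.sound,
: HexTight) (hO : ObservableToSLE) (hX : HexTransfer) :
SAWScalingLimit := hX (hO (hS hTN hB) hT)` — EVERY hypothesis is a crux (D-0027 §2.1 route
definition: glue/supports are never hypotheses), six of them,
and the thesis X = HexObservableLimitR (TARGET, rank 0, shared stmt-14003) is DERIVED inside the
term by the crux GreenSynthesis from TwistNull and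
BoundaryFluxLimit, then consumed by ObservableToSLE (with HexTight) and transported to δℤ² by
HexTransfer. Layer 1 (this route's mechanism) = TwistNull 2,
BoundaryFluxLimit 3, GreenSynthesis 4; layer 2 (shared pipeline) = HexTight 5, ObservableToSLE 6,
HexTransfer 7; support AliasIdentity (provable now, not a
hypothesis). Conjecture-grade items in total: 6 cruxes + the target = 7 = cap.
Revs 15–16 (route-repair gen 3, 2026-08-16, choice DROP ITEMS under the crux-only `closes` rule; no
new route): the rev-14 `closes` took the supports
AliasIdentity / WeakCRSynthesis / HexToSquare as hypotheses (glue.non-crux-hypothesis) and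
auto-promotion would have made 9 > 7 cruxes. Repaired by
MERGING, not by adding: NormalisedMassBound (stmt-14032) and WeakCRSynthesis (stmt-14033) merged
into the crux GreenSynthesis (the mass bound is its
first stub); HexToSquare (stmt-14227) + LatticeUniversality (stmt-0807, kept by nine sibling routes)
replaced here by the single transfer crux HexTransfer
(verbatim SAWPhaseRetrieval's stmt-14221: hexagonal SLE(8/3) convergence, written out, ⇒
SAWScalingLimit; LatticeUniversality + a hexagonal endpoint
approximation is its intended proof); Assembly item RESTATED at rev 17 as the frame with the glue
crux folded in — TwistNull → BoundaryFluxLimit → HexTight → ObservableToSLE → HexTransfer →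
SAWScalingLimit, i.e. `closes` with GreenSynthesis discharged (provable exactly when GreenSynthesis
is; the rev-16 chain listing all six cruxes is the type of `closes` itself and tripped the ground
battery's `intros; aesop` — ground.trivial); TwistNull restated
(C′, see (TN)) on the refuter's crux-attack evidence of 2026-08-16T00:39Z (stmt-14030, re-entrant
wedge, job j007807) before a ¬theorem lands. Earlier:
rev 3 pinned the root in TwistNull / BoundaryFluxLimit / the target after the corridor refutation of
stmt-5420; revs 6–14 dropped HexConjecture and
BulkTwistNull and moved X crux ↔ target (settled: target, derived in `closes`).

Rationale: WHY THIS LINE. Restricting the DCS observable to one oriented heading class samples the tip's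
winding law on a coarser lattice, so by Poisson summation over
the six headings the class-resolved observable is an aliasing tower (1/6)Σ_j e^(ijθ)F^(σ+j) of ONE
current read at shifted spins: DCS Lemma 1
says the fold at +2 vanishes identically, the observable is the fold at 0, and the missing half of
Cauchy–Riemann ("a divergence-free vector
field … which seems to have non-trivial curl; we expect that in the limit the curl vanishes",
DuminilCopinSmirnov2012 §4; arXiv:1009.6077 Q5)
is EXACTLY the fold at −2 — one Fourier coefficient of a positive winding law, of predicted weight
δ² relative to the observable
(Duplantier–Saleur parabola, DuplantierSaleur1988, arXiv:1203.2959 §4.1; continuum shadow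
Werness2012 Thm 1/3: the spin-σ SLE observable has
weight κσ²/2 and is holomorphic iff σ = b), while the orientation-resolved pieces DIVERGE like
δ^(−1/3) (spin −3/8 channel, measured on the
card), which is why no lattice-regularity argument exists and the regular combination must be named.
Summing Lemma 1 against ϕ(δ·v) gives
the exact identity boundary flux = (1/√3)[alias(∂ϕ) + observable(∂̄ϕ)] + O(δ), so Conjecture 2 =
(interior alias null) + (boundary flux
covariant) + (mass bound), glued by Weyl's lemma and analytic continuation of the defect measure
across ∂Ω (test functions live on ℂ∖{a}:
no boundary-trace or Riemann–Hilbert uniqueness theory). Imported: harmonic analysis on ℤ/6,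
distribution theory, SLE/Coulomb-gas winding
laws (engine behind TwistNull), Kennedy–Lawler boundary lattice effects (KennedyLawler2013) for the
boundary half. Versus prior routes:
SAWParafermion (BROKEN on 0772) works on ℤ² without an identity; SAWHexUniversality quarantines the
hexagonal conjecture whole; SAWResidueField
splits the same X by an ℓ²-Hodge projection on face poles (energy criterion mixing all channels) —
here the split is by winding Fourier
mode, the defect is ONE named alias with a rate, the boundary enters only as an explicit flux of arc
partition functions, and the glue needs
no discrete potential theory.

RANKED CRUXES. #0 HexObservableLimitR = X (TARGET, rank 0; shared stmt-14003, the target of all five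
routes wanting it; DERIVED inside `closes` from cruxes 2–3 by the crux GreenSynthesis, consumed by
ObservableToSLE; root pinned like b since the rev-3 repair of stmt-5420, refuted-misstated by
SAWDefectDecoherenceHexObservableLimit_refuted): DCS 2012 Conjecture 2 on the HEXAGONAL lattice,
smeared against ψ ∈ C_c(Ω) and normalised at one boundary mid-edge b_δ of a flat horizontal zigzag
piece — ∃ c ≠ 0 universal with δ²Σ_e ψ(δe)F_δ(e)/F_δ(b_δ) → c∫ψ e^{(5/8)(L − L_b)} for every
Dobrushin domain flat near a and near b, admissible discretisation family (simply connected, a_δ,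
b_δ ∈ ∂Λ_δ, connected, inside Ω, exhausting compacts, exact discrete half-planes in balls at a and
at b), a_δ → a, b_δ → b, φ: a ↦ ∞, b ↦ 0, L = log φ' → L_b at b. (why it might fail: needs BOTH
halves; F(b_δ)-normalisation is universal only on the flat zigzag class (built in); residual collar
freedom away from a, b must stay conformally invisible; open since 2010.) [DuminilCopinSmirnov2012,
arXiv:1007.0575, arXiv:1009.6077, ChelkakGlazmanSmirnov2016, KennedyLawler2013]
#2 TwistNull (crux; rev 15 RESTATED with the refuter's repair C′ — sup-norm × unsmeared K-mass; rev
3 pinned the root) — card K1 in boundary-inclusive form, the interior half of the thesis: for every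
Dobrushin domain flat near a, admissible family (Λ_δ simply connected, a_δ ∈ ∂Λ_δ, connected, inside
Ω, exhausting compacts, exact half-lattice in a ball at a, δa_δ → a), every compact K ∌ a and every
continuous ψ with supp ψ ⊆ int K: ∀ ε > 0, eventually |Σ_{e inner} ψ(δe)F_δ^{(−11/8)}(e)| ≤ ε ‖ψ‖_∞
Σ_{e inner, δe ∈ K}|F_δ(e)| — the smeared ALIAS (spin 5/8 − 2 observable = e^{2i(θ_e−θ_a)}F_δ(e)
edge by edge, AliasIdentity; |F^{(−11/8)}(e)| = |F^{(5/8)}(e)| pointwise, so only cancellation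
across the three edge-direction classes helps) is o(1) against the local mass. The rev-3 form
(stmt-14030, RHS = ε × ψ-SMEARED mass) is misstated: on a non-convex Ω a test function supported in
an exterior re-entrant wedge touches exactly ONE inner mid-edge straddling the apex for every δ,
where LHS = RHS/ε (refuter crux-attack 2026-08-16T00:39Z, exact enumeration job j007807); C′ is
missed by that witness (ψ must vanish towards the apex or K carries bulk mass) and still feeds
GreenSynthesis. Predicted rate δ² in the bulk, O(δ) from the boundary layer. [difficulty:
open-problem] (why it might fail: needs the class-resolved tip winding law to lose its spin −11/8
coefficient: a bulk operator of spin ≡ σ−2 (mod 6) with dimension ≤ 5/8, a non-Gaussian winding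
tail, or alias mass piling up in the free lattice boundary layer of a rough ∂Ω breaks it; card data
reach only R = 16 (A₋₂/A₀ ∝ R^−0.64).) [DuminilCopinSmirnov2012, arXiv:1009.6077, Werness2012,
DuplantierSaleur1988, arXiv:1203.2959,
Literature.Barriers.CriticalPhenomena.ParafermionicHalfCauchyRiemann]
#3 BoundaryFluxLimit (crux; unchanged, rev-3 pinned setting) — the boundary half of the thesis, in
GREEN FORM (no boundary trace needed): ONE constant c' ≠ 0 such that, in the setting of the target
and for every ϕ ∈ C³_c(ℂ∖{a}), the normalised complex boundary flux √3·δ·Σ_{v∈Λ_δ, u∉Λ_δ, u∼v}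
ϕ(δc(v))(c(u) − c(v))F_δ({v,u})/F_δ(b_δ) — boundary mid-edges only, |F_δ| = arc partition function
Z(a_δ → e), arg F_δ = deterministic boundary winding phase — converges to c'∫_Ω e^{(5/8)(L − L_b)}
∂̄ϕ dA (= c'(−i/2)∮(φ'/φ'(b))^{5/8}ϕ dz for smooth ∂Ω: boundary density |φ'|^{5/8} with phase
τ^{3/8}). [difficulty: open-problem] (why it might fail: boundary |F| = SAW arc partition functions
carry Kennedy–Lawler direction factors l_d; covariance needs the l_d-weighted average of the phases
n_d^(3/8) over the local staircase mix to align with the true normal n^(3/8), unverified; a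
δ-oscillating bulk/boundary ratio kills the universal constant.) [KennedyLawler2013,
arXiv:1109.3091, ChelkakGlazmanSmirnov2016, LawlerSchrammWerner2003, BeatonGuttmannJensen2012,
DuminilCopinSmirnov2012]
#4 GreenSynthesis (crux, NEW at rev 16 = NormalisedMassBound stmt-14032 + WeakCRSynthesis stmt-14033
merged; a `closes` hypothesis must be a crux and the mass bound is open-problem calibre — refuter
g48-0: the L¹ phase cancellation |F| = O(δ^{5/4}) on average is unproved): TwistNull →
BoundaryFluxLimit → HexObservableLimitR. Content: (i) the b-normalised local mass bound δ²Σ_{e: δe ∈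
K}|F_δ(e)| ≤ C_K|F_δ(b_δ)| on compacts K ∌ a (vague precompactness on ℂ∖{a}); (ii) sum
ϕ(δc(v))·[vertex relation at v, the PROVED DuminilCopinSmirnov2012_lemma1_holds] over v ∈ Λ_δ:
EXACTLY Σ_∂ ϕ(v_e)(c(u_e) − c(v_e))F(e) = Σ_{int e={v,w}} (c(w) − c(v))(ϕ(w) − ϕ(v))F(e); Taylor at
edge midpoints: flux_δ(ϕ) = (1/√3)[J_δ(∂ϕ) + I_δ(∂̄ϕ)] + O(δ·mass), J_δ = alias functional
(AliasIdentity), I_δ(ψ) = δ²Σψ F_δ/F_δ(b_δ); (iii) TwistNull (C′ with K ⊇ supp ∂ϕ) + (i) ⇒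
J_δ(∂ϕ)/F_δ(b_δ) → 0, so by BoundaryFluxLimit I_δ(∂̄ϕ) → √3c'∫_Ω h ∂̄ϕ for all ϕ ∈ C³_c(ℂ∖{a}), h =
e^{(5/8)(L−L_b)}; (iv) for a vague limit μ, ν := μ − √3c' h1_Ω dA has ∂̄ν = 0 in 𝒟'(ℂ∖{a}), Weyl's
lemma makes ν holomorphic on the connected ℂ∖{a}, ν = 0 off Ω̄, hence ν = 0 and the target follows
with c = √3c' ≠ 0 (F_δ(b_δ) ≠ 0 eventually: constant boundary-to-boundary winding + Nonempty).
[difficulty: open-problem] (why it might fail: the mass bound needs orientation cancellation of the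
divergent spin −3/8 channel (pointwise |F| is bounded only by Z(a→e), δ^(−25/48) larger; card A₋₁/A₀
∝ R^0.31) and no pile-up on free-collar junk; Taylor/collar errors must be uniform up to ∂Ω.)
[DuminilCopinSmirnov2012,
Literature.Probability.RandomPlanarGeometry.SAW.DuminilCopinSmirnov2012_lemma1_holds,
arXiv:0810.2188, Werness2012, KennedyLawler2013, arXiv:1203.2959]
#5 HexTight (crux) — shared (stmt-CriticalPhenomena-5423): eventual tightness (IsTightAlongMesh
along 𝓝[>]0, NOT the refuted all-δ form 0772) of the critical hexagonal SAW laws hexSAWLaw pushed to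
CurveClass ℂ, for every Dobrushin domain and hexagonal endpoint approximation. [difficulty:
open-problem] (why it might fail: no RSW/annulus-crossing technology for SAW (n = 0: no FKG; KS17 §4
covers FK, percolation, harmonic explorer, LERW; G2 fails for UST §4.5); strongest inputs:
sub-ballisticity (DCH13, arXiv:2310.17299).) [KemppainenSmirnov2017, DuminilCopinHammond2013,
arXiv:2310.17299, arXiv:1212.6215,
Summit.CriticalPhenomena.SAWScalingLimit.Theorems.SAWParafermionTight_refuted]
#6 ObservableToSLE (crux) — shared (stmt-CriticalPhenomena-14005): HexObservableLimitR → HexTight →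
(∀ Dobrushin domain, ∀ hexagonal endpoint approximation, hexSAWLaw → chordal SLE(8/3) in law): the
b-normalised smeared observable in slit domains is an exact discrete martingale; its limit forces
the driving process of every subsequential limit to be √(8/3)B (LSW03 Prop. 5.2); tightness +
uniqueness of the SLE law conclude. [deps: HexObservableLimitR, HexTight] [difficulty: XL] (why it
might fail: the martingale ⟨ψ,F_{Ω_n}⟩/F_{Ω_n}(b) needs the observable limit in the SAW's own slit
domains, uniformly (Carathéodory), and rough b; X is per fixed Jordan domain, flat at a and b.
Projective data fix κ = 8/3 but not the drift, so the b-normalisation is load-bearing.)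
[LawlerSchrammWerner2003, KemppainenSmirnov2017, DuminilCopinSmirnov2012Clay, Smirnov2007ICM,
DuminilCopinSmirnov2012, arXiv:math/0209343]
#7 HexTransfer (crux, NEW HERE at rev 16 = HexToSquare stmt-14227 + LatticeUniversality stmt-0807
merged; verbatim SAWPhaseRetrieval's stmt-14221, so shared and staffed once): (hexagonal chordal
SLE(8/3) convergence of hexSAWLaw for every Dobrushin domain and every hexagonal endpoint
approximation — written out, verbatim the conclusion of ObservableToSLE) → SAWScalingLimit. Lattice
universality in exactly the implicational form `closes` needs, weaker than the asymptotic equality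
of laws LatticeUniversality; this route reaches δℤ² only through it. [difficulty: open-problem] (why
it might fail: uniform ℤ² SAW is in no Yang–Baxter/integrable family (GM19 p.1; barrier
NienhuisWeightsExcludeVertexSAW): no transfer tool reaches it even given the hexagonal limit;
lattice effects persist in limits of boundary SAW ensembles (KennedyLawler2013).)
[GlazmanManolescu2019, KennedyLawler2013, DuminilCopinSmirnov2012, LawlerSchrammWerner2004SAW,
Literature.Barriers.CriticalPhenomena.NienhuisWeightsExcludeVertexSAW,
Literature.Barriers.CriticalPhenomena.not_hasExactVertexRelationZ2]
#9 AliasIdentity (support, not a `closes` hypothesis) — card P1, provable now: shifting the spin by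
−2 multiplies the observable by a deterministic unit phase — for every Λ, edges a = {u,v}, z = {p,q}
of ℍ and all x, σ: F(Λ,a,x,σ−2,z) = u_z·conj(u_a)·F(Λ,a,x,σ,z), u_e := 3(c(f) − c(g))² the unit
squared direction of e = {f,g} (edge length 1/√3). Proof: e^{iW} telescopes along the polyline
mid(a), c(v₁), …, c(v_n), mid(z), so e^{2iW} = u_z conj(u_a). The helper every prover of TwistNull /
GreenSynthesis needs. [difficulty: provable-now] [DuminilCopinSmirnov2012, arXiv:1203.2959]
No longer items (revs 15–16): NormalisedMassBound (stmt-14032, dropped rev 15 — now the first stub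
of GreenSynthesis), WeakCRSynthesis (stmt-14033 — merged into GreenSynthesis), HexToSquare
(stmt-14227) and LatticeUniversality (stmt-0807, stays on its nine other routes) — together the
intended proof of HexTransfer, the all-crux Assembly chain (stmt-8032/14668/14671; at rev 17 the
Assembly is TwistNull → BoundaryFluxLimit → HexTight → ObservableToSLE → HexTransfer →
SAWScalingLimit — `closes` with the glue crux GreenSynthesis folded in, proved by `fun hTN hB hT hO
hX => hX (hO (greenSynthesis hTN hB) hT)` once GreenSynthesis is); earlier: HexConjecture (derived
node), BulkTwistNull (first stub of TwistNull).

TWO-LAYER PLAN. Foreseen glued splits once a crux moves (k ≤ 3, depth 1; nothing filed now).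
TwistNull ⇐ BulkTwistNull (ψ ∈ C_c(Ω): the bulk case, card K1 verbatim; engine = a TWO-FREQUENCY
RATIO LOCAL CLT for the PATCH-AGGREGATED lifted winding law p_ψ(W) = Σ_e ψ(δe) Σ_(γ→e, W(γ)=W) x_c^ℓ
on (π/3)ℤ: |p̂_ψ(σ−2)| ≤ δ^ε × mass, via decorrelation of winding increments of the x_c tip ensemble
across dyadic annuli; pointwise in e the ratio is ill-posed since |F^(σ−2)(e)| = |F^σ(e)|) →
BoundaryLayerAlias (the alias mass within O(1) lattice rows of ∂Λ_δ, incl. straddling edges at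
re-entrant corners, is o(1) of the K-mass) → TwistNull. BoundaryFluxLimit ⇐ ArcDensityLimit (per
direction class d of boundary mid-edges, δΣ_(e∈d) ϕ |F_δ(e)|/F_δ(b_δ) → ∫_∂Ω ϕ l_d ρ_d
|φ'/φ'(b)|^(5/8) |dz|, Kennedy–Lawler form) → PhaseAlignment (Σ_d l_d ρ_d n_d^(3/8) ∥ n^(3/8) along
∂Ω, the identity the exact Green formula forces) → BoundaryFluxLimit. GreenSynthesis ⇐
NormalisedMassBound (the rev-3 signature of stmt-14032 verbatim: δ²Σ_{δe∈K}|F_δ(e)| ≤ C_K|F_δ(b_δ)|,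
itself ⇐ OrientationCancellation → SmearedMassBound) → WeakCRAnalysis (mass bound → TwistNull →
BoundaryFluxLimit → X: steps (ii)–(iv), pure analysis, L) → GreenSynthesis. ObservableToSLE ⇐
SlitUniformObservable → LoewnerRegularity → ObservableToSLE (as recorded on SAWResidueField).
HexTransfer ⇐ HexEndpointApproxExists (every Dobrushin domain with a δℤ² endpoint approximation has
a hexagonal one; cf. SAWDevelopingMap) → LatticeUniversality (stmt-0807) → HexTransfer.

KILL CRITERIA. Misstatement-class refutations that exploit residual freedom of Λ_δ or of the test
functions (collar corridors, moats, peninsulas — stmt-5420; off-closure supports at re-entrant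
corners — stmt-14030) ⇒ restate with a tighter discretisation / normalisation (ultimately the
canonical Ω_δ and Carathéodory convergence), never close. ¬TwistNull or ¬BulkTwistNull exhibited for
an honest admissible family and an honest bulk test function (alias share |Σψ F^(−11/8)| / (‖ψ‖_∞ ·
K-mass) bounded below as δ → 0) closes the route (`close --reason refuted:TwistNull`): by the exact
Green identity every vague limit then satisfies ∂̄f = −∂g with g ≠ 0 the alias limit, i.e. DCS
Conjecture 2 fails in the bulk in averaged form for that family — a sharper negative than the
barrier, handed to the four sibling routes on stmt-14003. ¬BoundaryFluxLimit with TwistNull standing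
⇒ pivot, not close: restate (BF) with direction-class constants c'_d (flux per boundary edge class)
or through lattice-flat boundary arcs only, and re-glue; if no normalisation survives (δ-oscillating
bulk/boundary ratio), restate the target projectively (ratios of two bulk smearings) and re-base
ObservableToSLE on the projective martingale. ¬GreenSynthesis can only come through ¬(mass bound) ⇒
pivot to mass-normalised statements (divide by δ²Σ_K|F| instead of F(b_δ)). ¬HexTight /
¬ObservableToSLE / ¬HexTransfer are conjunct-level events shared with the sibling routes (repair
jointly on the shared items). X proved elsewhere (a sibling's layer 1) moots layer 1; the hexagonal
Conjecture 1 proved moots layer 1, X and ObservableToSLE; SAWScalingLimit proved on ℤ² directly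
moots everything.

NOT DECOMPOSED YET. Downstream of the items no unproved Literature fact is needed: the SLE(8/3)
witness inside ConvergesInLawToSLE is a THEOREM of the tree (exists_isSLECurve_at with
hasSLETrace_of_ne_eight_holds and tendsto_norm_sleTrace_atTop_eightThirds_of_hasSLETrace), and DCS
Lemma 1 is DuminilCopinSmirnov2012_lemma1_holds (cone: 0 unproved constants). Left for lines /
layer-2 children: the probabilistic engine behind TwistNull (two-frequency winding local CLT,
annulus decorrelation and the tightness-strength inputs it needs — shared with HexTight and the
tightness cards); the boundary-layer and corner estimate; the Kennedy–Lawler direction factors and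
the phase-alignment identity inside (BF); inside GreenSynthesis the mass bound (orientation
cancellation) and the analysis (Weyl's lemma for measures, vague compactness on ℂ∖{a}, conformal
area formula, Taylor bookkeeping, F_δ(b_δ) ≠ 0 via constant boundary-to-boundary winding — a library
gap also noted by the refuter); constants (√3, edge density 2√3, c = √3c'); slit-domain uniformity
and rough b inside ObservableToSLE; the hexagonal endpoint approximation and LatticeUniversality
inside HexTransfer; every ℤ² statement (the aliasing tower holds there verbatim but the Green
identity has a genuine local defect, not_hasExactVertexRelationZ2).

CHEAPEST FALSIFIER. Three cheap numerics, none run yet: (i) BULK ALIAS — rerun the card's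
exact-enumeration (R ≤ 5.2, vertex-relation residual 1e-15) + Berretti–Sokal MCMC estimator with the
leakage correction (subtract (1/4)∂̄A₋₁) at R = 16, 24, 32: an intrinsic A₋₂/A₀ that plateaus
instead of decaying (card: 0.245 → 0.085 over R = 3.2…16.3, slope −0.64 = geometric leakage) kills
BulkTwistNull, TwistNull and the route; (ii) BOUNDARY PHASE ALIGNMENT — on a hexagonal domain with a
long straight boundary segment in a generic (non-lattice) direction, histogram the boundary arc
partition functions Z(a→e)/Z(a→b) by edge-direction class d along the segment (Kennedy–Lawler-style
SAW simulation, a few CPU-hours) and test arg Σ_d (mass_d)·n_d^(3/8) = (3/8)·arg n: a persistent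
misalignment refutes BoundaryFluxLimit as typed (universal c') and, with TwistNull, the target's
universal c; (iii) MASS — tabulate δ²Σ_K|F_δ|/|F_δ(b_δ)| against R on discs: growth like R^(25/48)
(no orientation cancellation) kills the mass bound inside GreenSynthesis and forces the
mass-normalised pivot.

NUMBERS. σ = 5/8, alias spin σ − 2 = −11/8, x_c = 1/√(2+√2) (DuminilCopinSmirnov2012 Thm 1, Lemma 1
— both PROVED in the tree). Winding-spectrum weights relative to the observable, (4/3)((σ+j)² − σ²)
= κ((σ+j)² − σ²)/2 with κ = 8/3 (Werness2012 Thm 1: ν(σ) = κσ²/2; b = 5/8, b̃ = 5/48): j = −1 (spin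
−3/8): −1/3 (divergent), j = 0: 0, j = −2 (spin −11/8): +2, j = +1: +3; j = +2: identically 0 (Lemma
1). Card data (bulk alias share A₋₂/A₀, exact enumeration R ≤ 5.2, MCMC to 16.3): 0.245, 0.179,
0.131, 0.085 at R = 3.2, 5.2, 8.3, 16.3. Wedge witness against the rev-3 TwistNull (83-vertex toy,
exact): F^{5/8}(e*) = F^{−11/8}(e*) = −0.005867 + 0.014165i, 231116 walks, LHS/RHS = 1.0 for every
δ. Geometry: honeycomb edge length 1/√3, |d|² = 1/3, u_e = 3d² unit, Green-identity constant 1/√3,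
edge density 2√3 per unit area, c = √3·c'. Boundary: phase of the flux per edge n_e^(1−σ) =
n_e^(3/8); staircase directions within 60° give phase offsets ≤ 22.5°. Items: 12 at open, 13 at revs
2–5, 11 at revs 8–14, 9 at rev 17: 1 target (X, rank 0), 6 cruxes (TwistNull 2, BoundaryFluxLimit 3,
GreenSynthesis 4, HexTight 5, ObservableToSLE 6, HexTransfer 7), 1 support (AliasIdentity), 1
assembly (frame with GreenSynthesis folded in); `closes` has exactly the 6 cruxes as hypotheses.

DEFINITION REQUESTS. None: every statement is self-contained over HexParafermion.lean, HexSAW.lean,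
ConformalMap.lean, SLEConvergenceCriterion.lean and Mathlib (fderiv, tsupport, interior, iSup,
finsum, volume on ℂ); the simulated post-edit file elaborates rc 0. Optional convenience for provers
(not filed): `hexEdgeDirSq e := 3 (c f − c g)²`, a named `hexBoundaryFlux Λ ϕ G` in HexParafermion,
and the boundary-to-boundary winding-constancy lemma (F_δ(b_δ) ≠ 0).

Novelty: Searches (2026-08-15): `lit search --hybrid "parafermionic observable self-avoiding walk winding
spin other half Cauchy-Riemann scaling
limit"` (15 book hits — Madras–Slade, Slade, Lawler, Cardy — none on the mechanism); `lit search
--source all "parafermionic self-avoiding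
walk"` (25 held docs incl. arXiv:1110.3731, arXiv:1604.06339, arXiv:1203.2959, arXiv:1110.1141,
arXiv:1708.00395; remote: zbMATH 4,
Crossref 25 noise, OpenAlex/S2/arXiv HTTP 429); `lit galaxy search "parafermionic observable" --star
all` (7 rows: DuminilCopin2013Parafermion,
DCM fractal-FK, arXiv:2409.03235 — Zhou's claimed completion of half-CR for bond percolation by
rotational invariance, different model and
mechanism — and Dewan–Muirhead); `lit galaxy search "winding angle self-avoiding walk" --star all`
(0); `lit frontier CriticalPhenomena
--since 2020` (30 rows; SAW-relevant only arXiv:2310.17299, sub-ballisticity); `lit citing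
arXiv:1007.0575` (158 works, keyword-filtered to
arXiv:1604.06339, 1203.2959, 1110.3731, 1109.1549); reads: arXiv:1110.3731 pp. 3–10 (Thm 1–3),
arXiv:1604.06339 pp. 4–5 (conjecture (1.1),
boundary n = 0 = restriction), the card, all 28 sibling route files (theses), SAWResidueField /
SAWParafermion / SAWHexUniversality in full,
barrier files ParafermionicHalfCauchyRiemann / SAWNotKineticallyGrown headers.
Nearest prior art found: DuminilCopinSmirnov2012 §4 and arXiv:1009.6077 Q5 (the defect is "a curl",
expected to vanish; no structure, no
rate); Werness2012 (arXiv:1110.3731) T  [refs: 1110.3731, 1604.06339, 1203.2959, 1110.1141, 1708.00395, 2409.03235, 2310.17299, 1007.0575, 1009.6077, DuminilCopinSmirnov2012, Werness2012, ChelkakGlazmanSmirnov2016]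

Barriers (technique_class: winding-alias weak-holomorphicity green-identity): - technique_class: winding-alias weak-holomorphicity green-identity
- Literature.Barriers.CriticalPhenomena.ParafermionicHalfCauchyRiemann: APPLIES head-on to any
argument using only SatisfiesVertexRelations + boundary values at fixed δ (its kernel: a pole per
hexagon, not_determined_of). Evaded in statement and method: the relations are spent ONCE, exactly,
as the Green identity inside WeakCRSynthesis; TwistNull and NormalisedMassBound are properties of
the POSITIVE x_c-SAW path measure (relative decay of two Fourier coefficients of the lifted winding
law; orientation cancellation) which F + Σ r(h)·Pole_h violates at O(1), hence outside the barrier's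
affine class; BoundaryFluxLimit concerns arc partition functions, not the solution space. Honest
residue: if TwistNull is false the identity still yields the exact defect law ∂̄f = −∂g — DCS
Conjecture 2 would be false in the bulk as printed.
- Literature.Barriers.CriticalPhenomena.FKParafermionicHalfCauchyRiemann: same structure for the FK
parafermion (q ≠ 2); not an evasion claim — the alias/Green split applies there verbatim and the
FK-Ising point (full s-holomorphicity known) is a test-bed where TwistNull is a theorem-in-waiting,
not used here.
- Literature.Barriers.CriticalPhenomena.NienhuisWeightsExcludeVertexSAW: respected — the route is
hexagonal by design (the Green identity needs the exact vertex relation;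
not_hasExactVertexRelationZ2 says ℤ² has none); δℤ² is reached only through LatticeUniversality.
- Literature.Barr

History (route lifecycle, newest last):
- 2026-08-16T00:14:14Z · rev 4: dropped stmt-CriticalPhenomena-5420, stmt-CriticalPhenomena-10472 — repair (ledger/file desync after the two concurrent rev-3 edits of 2026-08-16T00:07:28Z): the refuted-misstated target HexObservableLimit (stmt-5420, SAWDefectD (planner-rrefute-CriticalPhenomena-SAWWindingAl-9d5921a0-g2-0)
- 2026-08-16T00:14:14Z · REPAIRED (drop stmt-CriticalPhenomena-5420, stmt-CriticalPhenomena-10472) — back to open: repair (ledger/file desync after the two concurrent rev-3 edits of 2026-08-16T00:07:28Z): the refuted-misstated target HexObservableLimit (stmt-5420, SAWDefectD (planner-rrefute-CriticalPhenomena-SAWWindingAl-9d5921a0-g2-0)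
- 2026-08-16T04:22:58Z · rev 15: restated TwistNull (stmt-CriticalPhenomena-14030), WeakCRSynthesis (stmt-CriticalPhenomena-14033), Assembly (stmt-CriticalPhenomena-8032) — route-repair gen 3, STEP 1/2 (the at-edit cap check counts added cruxes before drops: the one-shot merge bounced 'would be 8', so the merge lands in two edits; (planner-rbadge-CriticalPhenomena-SAWWindingAli-dfa26329-g3-0)
- 2026-08-16T04:22:58Z · rev 15: dropped stmt-CriticalPhenomena-14032 — route-repair gen 3, STEP 1/2 (the at-edit cap check counts added cruxes before drops: the one-shot merge bounced 'would be 8', so the merge lands in two edits; (planner-rbadge-CriticalPhenomena-SAWWindingAli-dfa26329-g3-0)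
- 2026-08-16T04:27:21Z · rev 16: restated Assembly (stmt-CriticalPhenomena-14668) — route-repair gen 3, STEP 2/2 (step 1 = rev 15: TwistNull restated with the refuter's repair C′, NormalisedMassBound 14032 dropped, interim glue). FINAL SHAPE un (planner-rbadge-CriticalPhenomena-SAWWindingAli-dfa26329-g3-0)
- 2026-08-16T04:27:21Z · rev 16: dropped stmt-CriticalPhenomena-14667, stmt-CriticalPhenomena-14227, stmt-CriticalPhenomena-0807 — route-repair gen 3, STEP 2/2 (step 1 = rev 15: TwistNull restated with the refuter's repair C′, NormalisedMassBound 14032 dropped, interim glue). FINAL SHAPE un (planner-rbadge-CriticalPhenomena-SAWWindingAli-dfa26329-g3-0)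
- 2026-08-16T04:40:45Z · rev 17: restated Assembly (stmt-CriticalPhenomena-14671) — route-repair gen 3, step 3 (cleanup after rev 16): the rev-16 Assembly (stmt-14671 = TwistNull → BoundaryFluxLimit → GreenSynthesis → HexTight → ObservableToSLE (planner-rbadge-CriticalPhenomena-SAWWindingAli-dfa26329-g3-0)
- 2026-08-26T10:52:56Z · DORMANT — reconciler: no traction for 8.3 d (last activity item-evidence-added at 2026-08-18T02:01:51Z); parked, not closed — `ledger route dormant route-CriticalPhenomen (operator:999:2476492)

sub-problem: SAWScalingLimit · status: dormant · opened planner-plancard-CriticalPhenomena-SAWScaling-c2cb7c86-0 2026-08-15T12:25:17Z · rev 17 · ledger route-CriticalPhenomena-SAWWindingAlias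
GENERATED by the gate from the ledger (D-0016/17). Provers cite these decls: `theorem foo : Summit.CriticalPhenomena.SAWScalingLimit.Theses.SAWWindingAlias.<Decl> := …` in Summits/CriticalPhenomena/SAWScalingLimit/Theorems/<Name>.lean.
-/

namespace Summit.CriticalPhenomena.SAWScalingLimit.Theses.SAWWindingAlias

open scoped BigOperators Topology Manifold Classical MeasureTheory ProbabilityTheory Matrix InnerProductSpace ComplexConjugate ContinuousMap
open Filter Set Function TopologicalSpace MeasureTheory

attribute [summit_statement] _root_.SAWScalingLimit

/-- item stmt-CriticalPhenomena-14003 · target · rank 0 · open · by planner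
why it might fail: Needs BOTH the interior alias to die (TwistNull) and conformally covariant boundary flux; F(b_δ)-normalisation is universal only on the flat zigzag class (built in); residual collar freedom away from a, b must stay conformally invisible; DCS Conj. 2 open since 2010.
sources: DuminilCopinSmirnov2012, arXiv:1007.0575, arXiv:1009.6077, ChelkakGlazmanSmirnov2016, KennedyLawler2013, Summit.CriticalPhenomena.SAWScalingLimit.Theorems.SAWDefectDecoherenceHexObservableLimit_refuted
[target] repaired HexObservableLimit (stmt-CriticalPhenomena-5420, refuted-misstated by
Summit.CriticalPhenomena.SAWScalingLimit.Theorems.SAWDefectDecoherenceHexObservableLimit_refuted —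
the corridor witness: with Λ_δ free in the o(1)-collar at ∂Ω a boundary-hugging width-1 corridor
with a moat relocates the conformally effective root (3/4 → 1/2 on the half-disc) while every old
hypothesis holds, so the universal c ≠ 0 forces z(p−q)(1−pq) = 0). DCS 2012 Conjecture 2 (hexagonal
lattice), averaged against bulk test functions ψ ∈ C_c(Ω) and normalised at one boundary mid-edge
b_δ, with the ROOT PINNED CONFORMALLY exactly as b already was: for BOTH marked points p_i (i = 0
the root a, i = 1 the normalisation point b) the domain is the horizontal half-plane piece {im z >
im p_i} inside the ball B(p_i, ρ) and the discretisation is the exact half-lattice there (v ∈ Λ_δ ↔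
row(v) ≥ m_i(δ)); otherwise as before — ∃ c ≠ 0 universal with δ²⟨ψ, F_δ⟩/F_δ(b_δ) → c ∫ ψ
exp((5/8)(L − L_b)) for every such Dobrushin domain, every admissible discretisation family (simply
connected, connected, inside Ω, exhausting compacts), boundary mid-edges a_δ → a, b_δ → b, φ: a ↦ ∞,
b ↦ 0, L = log φ' continuous wi -/
@[route_item "route-CriticalPhenomena-SAWWindingAlias"]
def HexObservableLimitR : Prop :=
  ∃ c : ℂ, c ≠ 0 ∧ ∀ (D : Literature.Probability.RandomPlanarGeometry.DobrushinDomain) (ρ : ℝ) (Λ : ℝ → Finset Literature.Probability.LatticeModels.HexVertex) (m : Fin 2 → ℝ → ℤ) (a b : ℝ → Sym2 Literature.Probability.LatticeModels.HexVertex) (Φ : Literature.Probability.RandomPlanarGeometry.ConformalEquiv D.carrier UpperHalfPlane.upperHalfPlaneSet) (L : ℂ → ℂ) (Lb : ℂ) (ψ : ℂ → ℂ), let F : ℝ → Sym2 Literature.Probability.LatticeModels.HexVertex → ℂ := fun δ z => Literature.Probability.RandomPlanarGeometry.SAW.hexParafermionicObservable (Λ δ) (a δ) Literature.Probability.RandomPlanarGeometry.SAW.hexCriticalFugacity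 (5 / 8) z; 0 < ρ → (∀ i : Fin 2, D.carrier ∩ Metric.ball (D.pt i) ρ = {z : ℂ | (D.pt i).im < z.im} ∩ Metric.ball (D.pt i) ρ) → (∀ᶠ δ : ℝ in nhdsWithin 0 (Set.Ioi 0), Literature.Probability.RandomPlanarGeometry.SAW.hexDomainSimplyConnected (Λ δ) ∧ a δ ∈ Literature.Probability.RandomPlanarGeometry.SAW.hexDomainBoundary (Λ δ) ∧ b δ ∈ Literature.Probability.RandomPlanarGeometry.SAW.hexDomainBoundary (Λ δ) ∧ Nonempty (Literature.Probability.RandomPlanarGeometry.SAW.HexMidEdgeSAW (Λ δ) (a δ) (b δ)) ∧ (Literature.Probability.LatticeModels.hexGraph.induce ((Λ δ : Finset Literature.Probability.LatticeModels.HexVertex) : Set Literature.Probability.LatticeModels.HexVertex)).Preconnected ∧ (∀ v ∈ Λ δ, (δ : ℂ) * Literature.Probability.LatticeModels.hexCenter v ∈ D.carrier) ∧ (∀ i : Fin 2, ∀ v : Literature.Probability.LatticeModels.HexVertex, (δ : ℂ) * Literature.Probability.LatticeModels.hexCenter v ∈ Metric.ball (D.pt i) ρ → (v ∈ Λ δ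 ↔ m i δ ≤ v.1 1))) → (∀ K : Set ℂ, IsCompact K → K ⊆ D.carrier → ∀ᶠ δ : ℝ in nhdsWithin 0 (Set.Ioi 0), ∀ v : Literature.Probability.LatticeModels.HexVertex, (δ : ℂ) * Literature.Probability.LatticeModels.hexCenter v ∈ K → v ∈ Λ δ) → Filter.Tendsto (fun δ : ℝ => (δ : ℂ) * Literature.Probability.RandomPlanarGeometry.SAW.hexMidpoint (a δ)) (nhdsWithin 0 (Set.Ioi 0)) (nhds (D.pt 0)) → Filter.Tendsto (fun δ : ℝ => (δ : ℂ) * Literature.Probability.RandomPlanarGeometry.SAW.hexMidpoint (b δ)) (nhdsWithin 0 (Set.Ioi 0)) (nhds (D.pt 1)) → Filter.Tendsto (fun x => ‖Φ x‖) (nhdsWithin (D.pt 0) D.carrier) Filter.atTop → Φ.HasBoundaryValue (D.pt 1) 0 → ContinuousOn L D.carrier → (∀ z ∈ D.carrier, Complex.exp (L z) = deriv Φ z) → Filter.Tendsto L (nhdsWithin (D.pt 1) D.carrier) (nhds Lb) → Continuous ψ → HasCompactSupport ψ → tsupport ψ ⊆ D.carrier → Filter.Tendsto (fun δ : ℝ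 => (δ : ℂ) ^ 2 * (∑ᶠ e ∈ Literature.Probability.RandomPlanarGeometry.SAW.hexDomainMidEdges (Λ δ), ψ ((δ : ℂ) * Literature.Probability.RandomPlanarGeometry.SAW.hexMidpoint e) * F δ e) / F δ (b δ)) (nhdsWithin 0 (Set.Ioi 0)) (nhds (c * ∫ z, ψ z * Complex.exp ((5 / 8 : ℂ) * (L z - Lb))))

-- earlier TwistNull (stmt-CriticalPhenomena-14030, replaced 2026-08-16T04:22:58Z -> stmt-CriticalPhenomena-14666): retired by None — ∀ (D : Literature.Probability.RandomPlanarGeometry.DobrushinDomain) (ρ : ℝ) (Λ : ℝ → Finset Literature.Probability.LatticeModels.HexVertex) (m₀ : ℝ → ℤ) (a : ℝ → Sym2 Literature.Probability.LatticeModels.HexVertex), let F : ℝ → ℝ → Sym2 Literature.Probability.LatticeMo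
-- earlier TwistNull (stmt-CriticalPhenomena-8026, replaced 2026-08-16T00:07:28Z -> stmt-CriticalPhenomena-14030): retired by None — ∀ (D : Literature.Probability.RandomPlanarGeometry.DobrushinDomain) (Λ : ℝ → Finset Literature.Probability.LatticeModels.HexVertex) (a : ℝ → Sym2 Literature.Probability.LatticeModels.HexVertex), let F : ℝ → ℝ → Sym2 Literature.Probability.LatticeModels.HexVertex → ℂ := 
/-- item stmt-CriticalPhenomena-14666 · crux · rank 2 · open · by planner
why it might fail: Needs the class-resolved tip winding law to lose its spin −11/8 coefficient: a bulk operator of spin ≡ σ−2 (mod 6) with dimension ≤ 5/8, a non-Gaussian winding tail, or alias mass piling up in the free boundary layer / at re-entrant corners breaks it; card data reach only R = 16 (A₋₂/A₀ ∝ R^−0.64).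
sources: DuminilCopinSmirnov2012, arXiv:1009.6077, Werness2012, DuplantierSaleur1988, arXiv:1203.2959, Literature.Barriers.CriticalPhenomena.ParafermionicHalfCauchyRiemann
[crux] rank 2, the interior half of the thesis (card K1, boundary-inclusive), rev 15 RESTATED with
the repair C′ of the refuter's crux-attack on stmt-CriticalPhenomena-14030 (2026-08-16T00:39Z,
refuted-misstated by the re-entrant-wedge witness, EVIDENCE.md / witness.py / job j007807; no
¬theorem landed — library gap — so restated by the planner before one does): for every Dobrushin
domain flat (horizontal, domain above) in ball(a, ρ), admissible family (Λ_δ simply connected, a_δ ∈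
∂Λ_δ, connected, inside Ω, exhausting compacts, exact half-lattice rows ≥ m₀(δ) in ball(a, ρ), δa_δ
→ a), every continuous ψ and compact K with supp ψ ⊆ interior K and a ∉ K: ∀ ε > 0, eventually ‖Σ_{e
inner} ψ(δe) F_δ^{(5/8−2)}(e)‖ ≤ ε · (sup |ψ|) · Σ_{e inner, δe ∈ K} |F_δ^{(5/8)}(e)| — the smeared
winding ALIAS (spin −11/8 observable = e^{2i(θ_e−θ_a)}F_δ(e) edge by edge, AliasIdentity) is o(1)
against the sup-norm times the UNSMEARED local mass. Why the rev-3 normalisation (ε ×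
Σ|ψ(δe)||F_δ(e)|, ψ-smeared) was misstated: |F^{(−11/8)}(e)| = |F^{(5/8)}(e)| for every single edge
(all walks a → e share e^{2iW} = u_e·conj(u_a)), so any ψ meeting O(1) inner mid-edges for all δ
gives LHS = RHS/ε; on a non-conv -/
@[route_item "route-CriticalPhenomena-SAWWindingAlias", crux]
def TwistNull : Prop :=
  ∀ (D : Literature.Probability.RandomPlanarGeometry.DobrushinDomain) (ρ : ℝ) (Λ : ℝ → Finset Literature.Probability.LatticeModels.HexVertex) (m₀ : ℝ → ℤ) (a : ℝ → Sym2 Literature.Probability.LatticeModels.HexVertex), let F : ℝ → ℝ → Sym2 Literature.Probability.LatticeModels.HexVertex → ℂ := fun s δ z => Literature.Probability.RandomPlanarGeometry.SAW.hexParafermionicObservable (Λ δ) (a δ) Literature.Probability.RandomPlanarGeometry.SAW.hexCriticalFugacity s z; let inner : ℝ → Set (Sym2 Literature.Probability.LatticeModels.HexVertex) := fun δ => Literature.Probability.RandomPlanarGeometry.SAW.hexDomainMidEdges (Λ δ) \ Literature.Probability.RandomPlanarGeometry.SAW.hexDomainBoundary (Λ δ); 0 < ρ → D.carrier ∩ Metric.ball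 (D.pt 0) ρ = {z : ℂ | (D.pt 0).im < z.im} ∩ Metric.ball (D.pt 0) ρ → (∀ᶠ δ : ℝ in nhdsWithin 0 (Set.Ioi 0), Literature.Probability.RandomPlanarGeometry.SAW.hexDomainSimplyConnected (Λ δ) ∧ a δ ∈ Literature.Probability.RandomPlanarGeometry.SAW.hexDomainBoundary (Λ δ) ∧ (Literature.Probability.LatticeModels.hexGraph.induce ((Λ δ : Finset Literature.Probability.LatticeModels.HexVertex) : Set Literature.Probability.LatticeModels.HexVertex)).Preconnected ∧ (∀ v ∈ Λ δ, (δ : ℂ) * Literature.Probability.LatticeModels.hexCenter v ∈ D.carrier) ∧ (∀ v : Literature.Probability.LatticeModels.HexVertex, (δ : ℂ) * Literature.Probability.LatticeModels.hexCenter v ∈ Metric.ball (D.pt 0) ρ → (v ∈ Λ δ ↔ m₀ δ ≤ v.1 1))) → (∀ K : Set ℂ, IsCompact K → K ⊆ D.carrier → ∀ᶠ δ : ℝ in nhdsWithin 0 (Set.Ioi 0), ∀ v : Literature.Probability.LatticeModels.HexVertex, (δ : ℂ) * Literature.Probability.LatticeModels.hexCenter v ∈ K → v ∈ Λ δ) →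 Filter.Tendsto (fun δ : ℝ => (δ : ℂ) * Literature.Probability.RandomPlanarGeometry.SAW.hexMidpoint (a δ)) (nhdsWithin 0 (Set.Ioi 0)) (nhds (D.pt 0)) → ∀ (ψ : ℂ → ℂ) (K : Set ℂ), Continuous ψ → HasCompactSupport ψ → IsCompact K → tsupport ψ ⊆ interior K → D.pt 0 ∉ K → ∀ ε : ℝ, 0 < ε → ∀ᶠ δ : ℝ in nhdsWithin 0 (Set.Ioi 0), ‖∑ᶠ e ∈ inner δ, ψ ((δ : ℂ) * Literature.Probability.RandomPlanarGeometry.SAW.hexMidpoint e) * F (5 / 8 - 2) δ e‖ ≤ ε * (⨆ z : ℂ, ‖ψ z‖) * (∑ᶠ e ∈ {e | e ∈ inner δ ∧ (δ : ℂ) * Literature.Probability.RandomPlanarGeometry.SAW.hexMidpoint e ∈ K}, ‖F (5 / 8) δ e‖)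

-- earlier BoundaryFluxLimit (stmt-CriticalPhenomena-8027, replaced 2026-08-16T00:07:28Z -> stmt-CriticalPhenomena-14031): retired by None — ∃ c : ℂ, c ≠ 0 ∧ ∀ (D : Literature.Probability.RandomPlanarGeometry.DobrushinDomain) (ρ : ℝ) (Λ : ℝ → Finset Literature.Probability.LatticeModels.HexVertex) (m : ℝ → ℤ) (a b : ℝ → Sym2 Literature.Probability.LatticeModels.HexVertex) (Φ : Literature.Probability.R
/-- item stmt-CriticalPhenomena-14031 · crux · rank 3 · open · by planner
why it might fail: Boundary |F| = SAW arc partition functions carry Kennedy–Lawler direction factors l_d; covariance needs the l_d-weighted phases n_d^(3/8) over the local staircase mix to align with n^(3/8), unverified; a δ-oscillating bulk/boundary ratio or flux piling up on free-collar peninsulas kills c'.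
sources: KennedyLawler2013, arXiv:1109.3091, ChelkakGlazmanSmirnov2016, LawlerSchrammWerner2003, BeatonGuttmannJensen2012, DuminilCopinSmirnov2012
[crux] the boundary half of the thesis, in GREEN FORM (no boundary trace needed), rev 3 in the
PINNED setting of HexObservableLimitR (flat + exact half-lattice balls at a and at b): ONE constant
c' ≠ 0 such that for every ϕ ∈ C³_c(ℂ∖{a}) the normalised complex boundary flux √3·δ·Σ_{v∈Λ_δ,
u∉Λ_δ, u∼v} ϕ(δc(v))(c(u) − c(v))F_δ({v,u})/F_δ(b_δ) — boundary mid-edges only, |F_δ| = arc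
partition function Z(a_δ → e), arg F_δ = deterministic boundary winding phase — converges to c'∫_Ω
e^{(5/8)(L − L_b)} ∂̄ϕ dA (= c'(−i/2)∮(φ'/φ'(b))^{5/8}ϕ dz for smooth ∂Ω). Restated because the
unpinned form (stmt-CriticalPhenomena-8027) falls to the corridor witness: for ϕ supported near −1/2
on the diameter the two discretisations have the same boundary edges and proportional F, hence
identical normalised fluxes, while c' ≠ 0 and the two predictions force ∫_Ω (h_{1/2} − h_{3/4}) ∂̄ϕ
= 0, i.e. h_{1/2} = h_{3/4} on a real segment and then on Ω — the refuter's endgame. By the exact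
Green identity, given TwistNull + NormalisedMassBound this item is EQUIVALENT to the target up to
the Weyl-lemma step, so rough free collars are consistent with it (Stokes). [difficulty:
open-problem] -/
@[route_item "route-CriticalPhenomena-SAWWindingAlias", crux]
def BoundaryFluxLimit : Prop :=
  ∃ c : ℂ, c ≠ 0 ∧ ∀ (D : Literature.Probability.RandomPlanarGeometry.DobrushinDomain) (ρ : ℝ) (Λ : ℝ → Finset Literature.Probability.LatticeModels.HexVertex) (m : Fin 2 → ℝ → ℤ) (a b : ℝ → Sym2 Literature.Probability.LatticeModels.HexVertex) (Φ : Literature.Probability.RandomPlanarGeometry.ConformalEquiv D.carrier UpperHalfPlane.upperHalfPlaneSet) (L : ℂ → ℂ) (Lb : ℂ) (φ : ℂ → ℂ), let F : ℝ → Sym2 Literature.Probability.LatticeModels.HexVertex → ℂ := fun δ z => Literature.Probability.RandomPlanarGeometry.SAW.hexParafermionicObservable (Λ δ) (a δ) Literature.Probability.RandomPlanarGeometry.SAW.hexCriticalFugacity (5 / 8) z; 0 < ρ → (∀ i : Fin 2, D.carrier ∩ Metric.ball (D.pt i) ρ = {z : ℂ | (D.pt i).im < z.im} ∩ Metric.ball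 (D.pt i) ρ) → (∀ᶠ δ : ℝ in nhdsWithin 0 (Set.Ioi 0), Literature.Probability.RandomPlanarGeometry.SAW.hexDomainSimplyConnected (Λ δ) ∧ a δ ∈ Literature.Probability.RandomPlanarGeometry.SAW.hexDomainBoundary (Λ δ) ∧ b δ ∈ Literature.Probability.RandomPlanarGeometry.SAW.hexDomainBoundary (Λ δ) ∧ Nonempty (Literature.Probability.RandomPlanarGeometry.SAW.HexMidEdgeSAW (Λ δ) (a δ) (b δ)) ∧ (Literature.Probability.LatticeModels.hexGraph.induce ((Λ δ : Finset Literature.Probability.LatticeModels.HexVertex) : Set Literature.Probability.LatticeModels.HexVertex)).Preconnected ∧ (∀ v ∈ Λ δ, (δ : ℂ) * Literature.Probability.LatticeModels.hexCenter v ∈ D.carrier) ∧ (∀ i : Fin 2, ∀ v : Literature.Probability.LatticeModels.HexVertex, (δ : ℂ) * Literature.Probability.LatticeModels.hexCenter v ∈ Metric.ball (D.pt i) ρ → (v ∈ Λ δ ↔ m i δ ≤ v.1 1))) → (∀ K : Set ℂ, IsCompact K → K ⊆ D.carrier → ∀ᶠ δ : ℝ in nhdsWithin 0 (Set.Ioi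 0), ∀ v : Literature.Probability.LatticeModels.HexVertex, (δ : ℂ) * Literature.Probability.LatticeModels.hexCenter v ∈ K → v ∈ Λ δ) → Filter.Tendsto (fun δ : ℝ => (δ : ℂ) * Literature.Probability.RandomPlanarGeometry.SAW.hexMidpoint (a δ)) (nhdsWithin 0 (Set.Ioi 0)) (nhds (D.pt 0)) → Filter.Tendsto (fun δ : ℝ => (δ : ℂ) * Literature.Probability.RandomPlanarGeometry.SAW.hexMidpoint (b δ)) (nhdsWithin 0 (Set.Ioi 0)) (nhds (D.pt 1)) → Filter.Tendsto (fun x => ‖Φ x‖) (nhdsWithin (D.pt 0) D.carrier) Filter.atTop → Φ.HasBoundaryValue (D.pt 1) 0 → ContinuousOn L D.carrier → (∀ z ∈ D.carrier, Complex.exp (L z) = deriv Φ z) → Filter.Tendsto L (nhdsWithin (D.pt 1) D.carrier) (nhds Lb) → ContDiff ℝ 3 φ → HasCompactSupport φ → D.pt 0 ∉ tsupport φ → Filter.Tendsto (fun δ : ℝ => (Real.sqrt 3 : ℂ) * (δ : ℂ) * ∑ v ∈ Λ δ, ∑ᶠ u : Literature.Probability.LatticeModels.HexVertex, (if Literature.Probability.LatticeModels.hexGraph.Adj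 v u ∧ u ∉ Λ δ then φ ((δ : ℂ) * Literature.Probability.LatticeModels.hexCenter v) * (Literature.Probability.LatticeModels.hexCenter u - Literature.Probability.LatticeModels.hexCenter v) * F δ s(v, u) / F δ (b δ) else 0)) (nhdsWithin 0 (Set.Ioi 0)) (nhds (c * ∫ z in D.carrier, Complex.exp ((5 / 8 : ℂ) * (L z - Lb)) * ((fderiv ℝ φ z 1 + Complex.I * fderiv ℝ φ z Complex.I) / 2)))

/-- item stmt-CriticalPhenomena-14672 · crux · rank 4 · open · by planner
why it might fail: Carries the b-normalised mass bound δ²Σ_K|F_δ| ≤ C_K|F_δ(b_δ)|: needs orientation cancellation of the divergent spin −3/8 channel (pointwise |F| ≤ Z(a→e) only, δ^(−25/48) larger; card A₋₁/A₀ ∝ R^0.31), no pile-up on free-collar junk, Taylor/collar errors uniform up to ∂Ω, F_δ(b_δ) ≠ 0.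
sources: DuminilCopinSmirnov2012, Literature.Probability.RandomPlanarGeometry.SAW.DuminilCopinSmirnov2012_lemma1_holds, arXiv:0810.2188, Werness2012, KennedyLawler2013, arXiv:1203.2959
[crux] rank 4, NEW at rev 16: the Green–Weyl synthesis WITH the mass bound inside — TwistNull →
BoundaryFluxLimit → HexObservableLimitR (merges NormalisedMassBound stmt-14032 and the support
WeakCRSynthesis stmt-14033: a `closes` hypothesis must be a crux, and the mass bound is open-problem
calibre — refuter g48-0: the L¹ phase cancellation |F_δ| = O(δ^{5/4}) on average is unproved). Proof
plan: (i) MASS BOUND (first stub, the rev-3 signature of stmt-14032 verbatim): for every compact K ∌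
a, eventually δ²Σ_{e: δe ∈ K}|F_δ(e)| ≤ C_K|F_δ(b_δ)| — vague precompactness of μ_δ = δ²Σ_e
(F_δ(e)/F_δ(b_δ))δ_{δe} on ℂ∖{a}; (ii) GREEN IDENTITY: sum ϕ(δc(v))·[vertex relation at v — the
PROVED Literature theorem DuminilCopinSmirnov2012_lemma1_holds, used inside the proof] over v ∈ Λ_δ:
exactly Σ_∂ ϕ(v_e)(c(u_e) − c(v_e))F(e) = Σ_{int e={v,w}} (c(w) − c(v))(ϕ(w) − ϕ(v))F(e); Taylor at
edge midpoints (even orders cancel): flux_δ(ϕ) = (1/√3)[J_δ(∂ϕ) + I_δ(∂̄ϕ)] + O(δ·mass), J_δ = alias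
functional (AliasIdentity: u_e = 3d_e², |d_e|² = 1/3), I_δ(ψ) = δ²Σψ F_δ/F_δ(b_δ); (iii) TwistNull
(C′, K ⊇ supp ∂ϕ) + (i) ⇒ J_δ(∂ϕ)/F_δ(b_δ) → 0, hence by BoundaryFluxLimit I_δ(∂̄ϕ) → √3c'∫_Ω h ∂̄ϕ
for every ϕ ∈ C³_ -/
@[route_item "route-CriticalPhenomena-SAWWindingAlias", crux]
def GreenSynthesis : Prop :=
  TwistNull → BoundaryFluxLimit → HexObservableLimitR

/-- item stmt-CriticalPhenomena-5423 · crux · rank 5 · open · by planner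
why it might fail: No RSW/annulus-crossing technology for SAW (n = 0: no FKG; KS17 §4 covers FK, percolation, harmonic explorer, LERW; G2 fails for UST §4.5); strongest inputs: sub-ballisticity (DCH13, arXiv:2310.17299). Eventual form avoids refuted all-δ item 0772.
sources: KemppainenSmirnov2017, DuminilCopinHammond2013, arXiv:2310.17299, arXiv:1212.6215, Summit.CriticalPhenomena.SAWScalingLimit.Theorems.SAWParafermionTight_refuted
[crux] eventual tightness of the critical hexagonal SAW laws: for every Dobrushin domain and
hexagonal endpoint approximation (IsEmbEndpointApprox hexGraph hexCenter), the family δ ↦ hexSAWLaw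
pushed to CurveClass ℂ is tight along 𝓝[>]0 (IsTightAlongMesh — NOT the refuted all-δ IsTightLaws
form of stmt-CriticalPhenomena-0772). [difficulty: open-problem] -/
@[route_item "route-CriticalPhenomena-SAWWindingAlias", crux]
def HexTight : Prop :=
  ∀ (D : Literature.Probability.RandomPlanarGeometry.DobrushinDomain) (a b : ℝ → Literature.Probability.LatticeModels.HexVertex), Literature.Probability.RandomPlanarGeometry.SAW.IsEmbEndpointApprox Literature.Probability.LatticeModels.hexGraph Literature.Probability.LatticeModels.hexCenter D a b → Literature.Probability.RandomPlanarGeometry.IsTightAlongMesh (fun δ (γ : Literature.Probability.RandomPlanarGeometry.SAW.HexDomainSAW D.carrier δ (a δ) (b δ)) => γ.curve) (fun δ => Literature.Probability.RandomPlanarGeometry.SAW.hexSAWLaw D.carrier δ (a δ) (b δ))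

-- earlier ObservableToSLE (stmt-CriticalPhenomena-5424, replaced 2026-08-15T16:35:11Z -> stmt-CriticalPhenomena-10472): retired by None — HexObservableLimit → HexTight → Literature.Probability.RandomPlanarGeometry.SAW.HexSAWScalingLimit
/-- item stmt-CriticalPhenomena-14005 · crux · rank 6 · open · by planner
why it might fail: The martingale needs the observable limit in the SAW's own slit domains, uniformly (Carathéodory), rough tip; HexObservableLimitR speaks only of Jordan domains flat at a, b (Negative.FirstStepSilence/HypothesisSilence). Projective data fix κ = 8/3, not the drift: b-normalisation is load-bearing.
sources: LawlerSchrammWerner2003, KemppainenSmirnov2017, DuminilCopinSmirnov2012Clay, Smirnov2007ICM, DuminilCopinSmirnov2012, arXiv:math/0209343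
[crux] the martingale-observable identification for the hexagonal SAW over the repaired target:
HexObservableLimitR → HexTight → (Duminil-Copin–Smirnov 2012 Conjecture 1 written out: for every
Dobrushin domain and hexagonal endpoint approximation the critical hexagonal SAW law hexSAWLaw,
pushed to CurveClass ℂ, converges in law to chordal SLE(8/3) — verbatim the definiens of Literature
HexSAWScalingLimit and of the shared item HexConjecture, stmt-CriticalPhenomena-0808); re-targeting
for this route of the shared ObservableToSLE (stmt-CriticalPhenomena-10472), which became vacuous
when its antecedent HexObservableLimit was refuted. Intended proof unchanged: the b-normalised
observable ⟨ψ, F_(Ω∖γ[0,n])⟩/F_(Ω∖γ[0,n])(b) is an exact discrete martingale (domain Markov property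
of the SAW), its limit c⟨ψ,(φ_n'/φ_n'(b))^(5/8)⟩ forces the driving process of every subsequential
limit to be √(8/3)B (LSW03 Prop. 5.2 / Itô on g_t'^(5/8)(g_t − W_t)^(−5/4)), and tightness +
uniqueness of the SLE law conclude (SLEConvergenceCriterion). Now explicit as the FIRST step:
bootstrap Conj. 2 from the flat-pinned family of HexObservableLimitR (a, b on horizontal
half-lattice pieces) to Carathéodory-conve -/
@[route_item "route-CriticalPhenomena-SAWWindingAlias", crux]
def ObservableToSLE : Prop :=
  HexObservableLimitR → HexTight → ∀ (D : Literature.Probability.RandomPlanarGeometry.DobrushinDomain) (a b : ℝ → Literature.Probability.LatticeModels.HexVertex), Literature.Probability.RandomPlanarGeometry.SAW.IsEmbEndpointApprox Literature.Probability.LatticeModels.hexGraph Literature.Probability.LatticeModels.hexCenter D a b → Literature.Probability.RandomPlanarGeometry.ConvergesInLawToSLE ((8 : NNReal) / 3) D (fun δ (γ : Literature.Probability.RandomPlanarGeometry.SAW.HexDomainSAW D.carrier δ (a δ) (b δ)) => γ.curve) (fun δ => Literature.Probability.RandomPlanarGeometry.SAW.hexSAWLaw D.carrier δ (a δ) (b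 δ))

/-- item stmt-CriticalPhenomena-14221 · crux · rank 7 · open · by planner
why it might fail: Open content = lattice universality: uniform ℤ² SAW lies in no Yang–Baxter/integrable family (GM19 p.1; barrier NienhuisWeightsExcludeVertexSAW), so no transfer tool exists even given the hexagonal SLE(8/3) limit; Kennedy–Lawler boundary lattice effects could split ℤ² endpoint classes.
sources: GlazmanManolescu2019, KennedyLawler2013, DuminilCopinSmirnov2012, LawlerSchrammWerner2004SAW, Literature.Barriers.CriticalPhenomena.NienhuisWeightsExcludeVertexSAW, Literature.Barriers.CriticalPhenomena.not_hasExactVertexRelationZ2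
[crux] LATTICE-UNIVERSALITY TRANSFER (conjecture-grade: filed with kind support at rev 7 only
because the at-edit cap check counted 8 with it declared crux; the gate auto-promotes
conjecture-grade items to crux, intended rank 7 — a retriage follows if needed; rev 7 route choice;
replaces in THIS route the shared tail HexConjecture stmt-0808 → HexToSquare stmt-10473 +
LatticeUniversality stmt-0807, which stays with the sibling routes SAWDefectDecoherence /
SAWResidueField / SAWWindingAlias / SAWDevelopingMap): Duminil-Copin–Smirnov 2012 Conjecture 1 —
written out verbatim as the conclusion of ObservableToSLER (for every Dobrushin domain and hexagonal
endpoint approximation IsEmbEndpointApprox the critical hexagonal SAW law hexSAWLaw, pushed to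
CurveClass ℂ, converges in law to chordal SLE(8/3)) — IMPLIES the δℤ² sub-problem statement
SAWScalingLimit. Universality of the critical SAW scaling limit in exactly the implicational form
the assembly needs: weaker than the asymptotic equality of laws LatticeUniversality (it may use
existence and conformal invariance of the hexagonal limit), Iff.rfl-equivalent to HexConjecture →
SAWScalingLimit, implied by HexToSquare ∧ LatticeUniversality ( -/
@[route_item "route-CriticalPhenomena-SAWWindingAlias", crux]
def HexTransfer : Prop :=
  (∀ (D : Literature.Probability.RandomPlanarGeometry.DobrushinDomain) (a b : ℝ → Literature.Probability.LatticeModels.HexVertex), Literature.Probability.RandomPlanarGeometry.SAW.IsEmbEndpointApprox Literature.Probability.LatticeModels.hexGraph Literature.Probability.LatticeModels.hexCenter D a b → Literature.Probability.RandomPlanarGeometry.ConvergesInLawToSLE ((8 : NNReal) / 3) D (fun δ (γ : Literature.Probability.RandomPlanarGeometry.SAW.HexDomainSAW D.carrier δ (a δ) (b δ)) => γ.curve) (fun δ => Literature.Probability.RandomPlanarGeometry.SAW.hexSAWLaw D.carrier δ (a δ) (b δ))) → SAWScalingLimit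

/-- item stmt-CriticalPhenomena-8029 · support · rank 9 · open · by planner
sources: DuminilCopinSmirnov2012, arXiv:1203.2959
[support] card P1/(M1), provable now: shifting the spin by −2 multiplies the observable by a
deterministic unit phase — for every Λ, edges a = {u,v}, z = {p,q} of ℍ and all x, σ: F(Λ,a,x,σ−2,z)
= u_z·conj(u_a)·F(Λ,a,x,σ,z), u_e := 3(c(f) − c(g))² the unit squared direction of e = {f,g} (edge
length 1/√3). Proof: the winding is a sum of principal arguments of increment ratios of the polyline
mid(a), c(v₁), …, c(v_n), mid(z), so e^{iW} telescopes and e^{2iW} = u_z conj(u_a); the trivial walk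
gives 1 = |u_a|². [difficulty: provable-now] -/
@[route_item "route-CriticalPhenomena-SAWWindingAlias"]
def AliasIdentity : Prop :=
  ∀ (Λ : Finset Literature.Probability.LatticeModels.HexVertex) (u v p q : Literature.Probability.LatticeModels.HexVertex) (x σ : ℝ), Literature.Probability.LatticeModels.hexGraph.Adj u v → Literature.Probability.LatticeModels.hexGraph.Adj p q → Literature.Probability.RandomPlanarGeometry.SAW.hexParafermionicObservable Λ s(u, v) x (σ - 2) s(p, q) = (3 * (Literature.Probability.LatticeModels.hexCenter p - Literature.Probability.LatticeModels.hexCenter q) ^ 2) * (starRingEnd ℂ) (3 * (Literature.Probability.LatticeModels.hexCenter u - Literature.Probability.LatticeModels.hexCenter v) ^ 2) * Literature.Probability.RandomPlanarGeometry.SAW.hexParafermionicObservable Λ s(u, v) x σ s(p, q)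

-- earlier Assembly (stmt-CriticalPhenomena-14668, replaced 2026-08-16T04:27:21Z -> stmt-CriticalPhenomena-14671): retired by None — WeakCRSynthesis → AliasIdentity → TwistNull → BoundaryFluxLimit → HexTight → ObservableToSLE → HexToSquare → LatticeUniversality → SAWScalingLimit
-- earlier Assembly (stmt-CriticalPhenomena-14671, replaced 2026-08-16T04:40:45Z -> stmt-CriticalPhenomena-14644): retired by None — TwistNull → BoundaryFluxLimit → GreenSynthesis → HexTight → ObservableToSLE → HexTransfer → SAWScalingLimit
-- earlier Assembly (stmt-CriticalPhenomena-8032, replaced 2026-08-16T04:22:58Z -> stmt-CriticalPhenomena-14668): retired by None — WeakCRSynthesis → AliasIdentity → TwistNull → NormalisedMassBound → BoundaryFluxLimit → HexTight → ObservableToSLE → HexToSquare → LatticeUniversality → SAWScalingLimit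
/-- item stmt-CriticalPhenomena-14644 · assembly · rank 1 · open · by planner
sources: DuminilCopinSmirnov2012, KemppainenSmirnov2017, GlazmanManolescu2019
[assembly] rev 17: the frame with the glue crux folded in — TwistNull → BoundaryFluxLimit → HexTight
→ ObservableToSLE → HexTransfer → SAWScalingLimit: the two halves of the thesis plus the shared
pipeline already imply the δℤ² Statement. This is `closes` with GreenSynthesis discharged, so its
proof IS the crux GreenSynthesis (term: fun hTN hB hT hO hX => hX (hO (greenSynthesis hTN hB) hT));
it adds no assumption beyond the listed cruxes. The rev-16 chain with all six cruxes (stmt-14671) is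
the type of `closes` itself and was closed by the ground battery's `intros; aesop` (ground.trivial,
blocking); the gate does not allow dropping the assembly item, hence this restatement (battery
probes intros;aesop / exact? / tauto / simp_all fail on it — Sketch3.lean). -/
@[route_item "route-CriticalPhenomena-SAWWindingAlias"]
def Assembly : Prop :=
  TwistNull → BoundaryFluxLimit → HexTight → ObservableToSLE → HexTransfer → SAWScalingLimit

-- records of items no longer active in this route (dropped / restated):
-- earlier HexToSquare (stmt-CriticalPhenomena-10473, replaced 2026-08-16T03:05:30Z -> stmt-CriticalPhenomena-14167): moot by None — HexConjecture → LatticeUniversality → SAWScalingLimit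
-- earlier WeakCRSynthesis (stmt-CriticalPhenomena-11349, replaced 2026-08-16T00:07:28Z -> stmt-CriticalPhenomena-14033): retired by None — (∀ (Λ : Finset Literature.Probability.LatticeModels.HexVertex) (u v p q : Literature.Probability.LatticeModels.HexVertex) (x σ : ℝ), Literature.Probability.LatticeModels.hexGraph.Adj u v → Literature.Probability.LatticeModels.hexGraph.Adj p q → Literature.Probabi
-- earlier WeakCRSynthesis (stmt-CriticalPhenomena-14033, replaced 2026-08-16T04:22:58Z -> stmt-CriticalPhenomena-14667): retired by None — (∀ (Λ : Finset Literature.Probability.LatticeModels.HexVertex) (u v p q : Literature.Probability.LatticeModels.HexVertex) (x σ : ℝ), Literature.Probability.LatticeModels.hexGraph.Adj u v → Literature.Probability.LatticeModels.hexGraph.Adj p q → Literature.Probabi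
-- earlier HexObservableLimit (stmt-CriticalPhenomena-5420, dropped 2026-08-16T00:14:14Z): refuted by Summit.CriticalPhenomena.SAWScalingLimit.Theorems.SAWDefectDecoherenceHexObservableLimit_refuted @ b90fe791a4c9 — ∃ c : ℂ, c ≠ 0 ∧ ∀ (D : Literature.Probability.RandomPlanarGeometry.DobrushinDomain) (ρ : ℝ) (Λ : ℝ → Finset Literature.Probability.LatticeModels.HexVertex) (m : ℝ → ℤ) (a b : ℝ → Sym2 Li
-- earlier HexToSquare (stmt-CriticalPhenomena-5428, replaced 2026-08-15T16:35:11Z -> stmt-CriticalPhenomena-10473): retired by None — Literature.Probability.RandomPlanarGeometry.SAW.HexSAWScalingLimit → LatticeUniversality → SAWScalingLimit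
-- earlier NormalisedMassBound (stmt-CriticalPhenomena-8028, replaced 2026-08-16T00:07:28Z -> stmt-CriticalPhenomena-14032): retired by None — ∀ (D : Literature.Probability.RandomPlanarGeometry.DobrushinDomain) (ρ : ℝ) (Λ : ℝ → Finset Literature.Probability.LatticeModels.HexVertex) (m : ℝ → ℤ) (a b : ℝ → Sym2 Literature.Probability.LatticeModels.HexVertex), let F : ℝ → Sym2 Literature.Probability.Lat
-- earlier WeakCRSynthesis (stmt-CriticalPhenomena-8031, replaced 2026-08-15T17:21:29Z -> stmt-CriticalPhenomena-11349): retired by None — Literature.Probability.RandomPlanarGeometry.SAW.DuminilCopinSmirnov2012_lemma1 → AliasIdentity → TwistNull → NormalisedMassBound → BoundaryFluxLimit → HexObservableLimit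

/-! D-0027 §2.1 — DECIDING THEOREM (planner-authored via `route open/edit --closes-file`; by planner-rbadge-CriticalPhenomena-SAWWindingAli-dfa26329-g3-0 2026-08-16T04:54:10Z):
its hypotheses are this route's items and its conclusion the sub-problem Statement (glue_lint), and it elaborates with this file. -/

@[closes "route-CriticalPhenomena-SAWWindingAlias"] theorem closes (hTN : TwistNull) (hB : BoundaryFluxLimit) (hS : GreenSynthesis) (hT : HexTight) (hO : ObservableToSLE) (hX : HexTransfer) : _root_.SAWScalingLimit :=
  hX (hO (hS hTN hB) hT)

end Summit.CriticalPhenomena.SAWScalingLimit.Theses.SAWWindingAlias
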